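import Mathlib

/-!
# Cyclic divisorial transfer: invariants commute with localisation at a totally ramified prime

Stub `stub_locFixed` of the local algebra behind "Király–Lütkebohmert terminal state ⟹ regular
quotient" (crux stmt-ResolutionOfSingularities-15640, line `Sketch`).

`B` a domain, `σ` a ring automorphism with `σ ^ p = 1` (`p` prime), `A = B^σ = eqLocus σ id`,
`𝔮 ⊂ B` a prime with `σ⁻¹𝔮 = 𝔮`, `𝔭 = 𝔮 ∩ A`, and `σ'` any automorphism of `B_𝔮` compatible with
`σ`.  Then the canonical local homomorphism `A_𝔭 → B_𝔮` is injective and its image is exactly the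
fixed ring of `σ'`.  The proof is the classical norm argument: for `t ∈ B` the norm
`N t = ∏_{i<p} σⁱ t` is fixed by `σ`, is a multiple of `t`, say `N t = u t`, and lies outside `𝔮`
when `t` does; so every fraction `b / t ∈ B_𝔮` can be rewritten with a `σ`-invariant denominator,
`b / t = (u b) / (N t)`, and if `σ'` fixes it then `σ (u b) = u b` because `B → B_𝔮` is injective
(`B` is a domain).  Only Mathlib is used. [folklore; Bourbaki AC V §1 no. 9 Prop. 23]
-/

set_option linter.dupNamespace false

noncomputable section

namespace Summit.ResolutionOfSingularities.ResolutionOfSingularities.Theorems.WildQuotientResolution.CyclicTransfer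

/-- If `σ⁻¹𝔮 = 𝔮` then every iterate of `σ` preserves membership in `𝔮`: `σⁱ b ∈ 𝔮 ↔ b ∈ 𝔮`. -/
theorem locFixed_pow_apply_mem_iff {B : Type} [CommRing B] (σ : B ≃+* B) (𝔮 : Ideal B)
    (h𝔮 : 𝔮.comap σ = 𝔮) (i : ℕ) (b : B) : (σ ^ i) b ∈ 𝔮 ↔ b ∈ 𝔮 := by
  have key : ∀ y : B, y ∈ 𝔮 ↔ σ y ∈ 𝔮 := fun y => by
    conv_lhs => rw [← h𝔮]
    exact Ideal.mem_comap
  induction i with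
  | zero => rw [pow_zero, RingAut.one_apply]
  | succ i ih =>
    rw [pow_succ', RingAut.mul_apply, ← key]
    exact ih

/-- The norm `∏_{i ≤ n} σⁱ t` of `t` with respect to an automorphism `σ` with `σ ^ (n + 1) = 1`
is fixed by `σ`. -/
theorem locFixed_apply_norm {B : Type} [CommRing B] (σ : B ≃+* B) {n : ℕ} (hσ : σ ^ (n + 1) = 1)
    (t : B) :
    σ (∏ i ∈ Finset.range (n + 1), (σ ^ i) t) = ∏ i ∈ Finset.range (n + 1), (σ ^ i) t := by
  have h1 : ∀ i : ℕ, σ ((σ ^ i) t) = (σ ^ (i + 1)) t := fun i => by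
    rw [pow_succ', RingAut.mul_apply]
  rw [map_prod σ]
  simp_rw [h1]
  rw [Finset.prod_range_succ, Finset.prod_range_succ', hσ, pow_zero]

/-- The norm splits off the factor `t`: `∏_{i ≤ n} σⁱ t = (∏_{i < n} σⁱ⁺¹ t) * t`. -/
theorem locFixed_norm_eq {B : Type} [CommRing B] (σ : B ≃+* B) (n : ℕ) (t : B) :
    ∏ i ∈ Finset.range (n + 1), (σ ^ i) t = (∏ i ∈ Finset.range n, (σ ^ (i + 1)) t) * t := by
  rw [Finset.prod_range_succ', pow_zero, RingAut.one_apply]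

/-- A product of iterates `σ ^ (e i)` applied to an element `t ∉ 𝔮` lies outside the `σ`-stable
prime `𝔮`. -/
theorem locFixed_prod_pow_apply_notMem {B : Type} [CommRing B] (σ : B ≃+* B) (𝔮 : Ideal B)
    [𝔮.IsPrime] (h𝔮 : 𝔮.comap σ = 𝔮) {t : B} (ht : t ∉ 𝔮) (s : Finset ℕ) (e : ℕ → ℕ) :
    ∏ i ∈ s, (σ ^ e i) t ∉ 𝔮 :=
  Ideal.mem_primeCompl_iff.mp <| prod_mem fun i _ =>
    Ideal.mem_primeCompl_iff.mpr fun h => ht ((locFixed_pow_apply_mem_iff σ 𝔮 h𝔮 (e i) t).mp h)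

/-- An automorphism `σ'` of `B_𝔮` compatible with `σ` fixes every fraction `a / s` whose numerator
and denominator are fixed by `σ`. -/
theorem locFixed_apply_mk' {B : Type} [CommRing B] (σ : B ≃+* B) (𝔮 : Ideal B) [𝔮.IsPrime]
    (σ' : Localization.AtPrime 𝔮 ≃+* Localization.AtPrime 𝔮)
    (hσ' : ∀ b : B, σ' (algebraMap B (Localization.AtPrime 𝔮) b) =
      algebraMap B (Localization.AtPrime 𝔮) (σ b))
    {a : B} {s : 𝔮.primeCompl} (ha : σ a = a) (hs : σ s = s) :
    σ' (IsLocalization.mk' (Localization.AtPrime 𝔮) a s) =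
      IsLocalization.mk' (Localization.AtPrime 𝔮) a s := by
  rw [IsLocalization.eq_mk'_iff_mul_eq]
  calc σ' (IsLocalization.mk' (Localization.AtPrime 𝔮) a s) * algebraMap B _ s
      = σ' (IsLocalization.mk' (Localization.AtPrime 𝔮) a s) * σ' (algebraMap B _ s) := by
        rw [hσ', hs]
    _ = σ' (algebraMap B _ a) := by rw [← map_mul, IsLocalization.mk'_spec]
    _ = algebraMap B _ a := by rw [hσ', ha]

/-- **Invariants commute with localisation at a totally ramified prime.**
`B` a domain, `σ` an automorphism with `σ ^ p = 1` (`p` prime), `A = B^σ = eqLocus σ id`, `𝔮` a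
prime of `B` with `σ⁻¹𝔮 = 𝔮`, `𝔭 = 𝔮 ∩ A`, and `σ'` ANY automorphism of `B_𝔮` compatible with `σ`.
Then the canonical local map `A_𝔭 → B_𝔮` is injective with image the fixed ring of `σ'`.
(Every `t ∈ B ∖ 𝔮` divides its norm `N t = ∏_{i<p} σⁱ t ∈ A ∖ 𝔭`, so `B_𝔮 = S⁻¹B` with
`S = A ∖ 𝔭`, and `(S⁻¹B)^σ = S⁻¹A` in a domain.) [folklore; Bourbaki AC V §1 no. 9 Prop. 23] -/
theorem stub_locFixed {B : Type} [CommRing B] [IsDomain B] {p : ℕ} (hp : p.Prime)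
    (σ : B ≃+* B) (hσp : σ ^ p = RingEquiv.refl B)
    (𝔮 : Ideal B) [𝔮.IsPrime] (h𝔮 : 𝔮.comap σ = 𝔮)
    (σ' : Localization.AtPrime 𝔮 ≃+* Localization.AtPrime 𝔮)
    (hσ' : ∀ b : B, σ' (algebraMap B (Localization.AtPrime 𝔮) b) =
      algebraMap B (Localization.AtPrime 𝔮) (σ b)) :
    Function.Injective (Localization.localRingHom (𝔮.comap ((σ : B →+* B).eqLocus (RingHom.id B)).subtype) 𝔮
        ((σ : B →+* B).eqLocus (RingHom.id B)).subtype rfl) ∧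
      (Localization.localRingHom (𝔮.comap ((σ : B →+* B).eqLocus (RingHom.id B)).subtype) 𝔮
        ((σ : B →+* B).eqLocus (RingHom.id B)).subtype rfl).range =
        (σ' : Localization.AtPrime 𝔮 →+* Localization.AtPrime 𝔮).eqLocus (RingHom.id _) := by
  -- write `p = n + 1`, so that `σ ^ (n + 1) = 1`
  obtain ⟨n, rfl⟩ : ∃ n, p = n + 1 := ⟨p - 1, (Nat.sub_add_cancel hp.one_lt.le).symm⟩
  have hσ1 : σ ^ (n + 1) = 1 := hσp
  -- `B` is a domain, so `B → B_𝔮` is injective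
  have hinjL : Function.Injective (algebraMap B (Localization.AtPrime 𝔮)) :=
    IsLocalization.injective (Localization.AtPrime 𝔮) 𝔮.primeCompl_le_nonZeroDivisors
  refine ⟨?_, ?_⟩
  · -- injectivity: `a / s ↦ 0` forces `m a = 0` for some `m ∉ 𝔮`, hence `a = 0`
    rw [injective_iff_map_eq_zero]
    intro x hx
    obtain ⟨⟨a, s⟩, rfl⟩ := IsLocalization.mk'_surjective
      (𝔮.comap ((σ : B →+* B).eqLocus (RingHom.id B)).subtype).primeCompl x
    rw [Localization.localRingHom_mk', IsLocalization.mk'_eq_zero_iff] at hx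
    obtain ⟨m, hm⟩ := hx
    have hm0 : (m : B) ≠ 0 := fun h => m.2 (h ▸ 𝔮.zero_mem)
    have ha' : (a : B) = 0 := (mul_eq_zero.mp hm).resolve_left hm0
    have ha : a = 0 := ZeroMemClass.coe_eq_zero.mp ha'
    rw [ha]
    exact IsLocalization.mk'_zero _
  · -- the image is the fixed ring of `σ'`
    ext x
    rw [RingHom.mem_range, RingHom.mem_eqLocus]
    constructor
    · -- `⊆`: fractions with `σ`-invariant numerator and denominator are fixed by `σ'`
      rintro ⟨y, rfl⟩
      obtain ⟨⟨a, s⟩, rfl⟩ := IsLocalization.mk'_surjective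
        (𝔮.comap ((σ : B →+* B).eqLocus (RingHom.id B)).subtype).primeCompl y
      rw [Localization.localRingHom_mk']
      exact locFixed_apply_mk' σ 𝔮 σ' hσ' a.2 s.1.2
    · -- `⊇`: rewrite `b / t` as `(u b) / (N t)` with the `σ`-invariant denominator `N t = u t`
      intro hx
      obtain ⟨⟨b, t⟩, rfl⟩ := IsLocalization.mk'_surjective 𝔮.primeCompl x
      have hx' : σ' (IsLocalization.mk' (Localization.AtPrime 𝔮) b t) =
          IsLocalization.mk' (Localization.AtPrime 𝔮) b t := hx
      obtain ⟨u, hu⟩ : ∃ u : B, (∏ i ∈ Finset.range n, (σ ^ (i + 1)) (t : B)) = u := ⟨_, rfl⟩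
      have hN : σ (u * t) = u * t := by
        rw [← hu, ← locFixed_norm_eq]
        exact locFixed_apply_norm σ hσ1 t
      have hu𝔮 : u ∉ 𝔮 := by
        rw [← hu]
        exact locFixed_prod_pow_apply_notMem σ 𝔮 h𝔮 t.2 _ _
      have hut : u * t ∉ 𝔮 := ‹𝔮.IsPrime›.mul_notMem hu𝔮 t.2
      have e1 : IsLocalization.mk' (Localization.AtPrime 𝔮) b t * algebraMap B _ (u * t) =
          algebraMap B _ (u * b) := by
        rw [map_mul, map_mul, mul_left_comm, IsLocalization.mk'_spec]
      -- `σ'` fixes `b / t`, hence `σ (u b) = u b` in `B_𝔮`, hence in `B`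
      have hub : σ (u * b) = u * b := by
        apply hinjL
        have e2 := congrArg σ' e1
        rw [map_mul, hx', hσ', hN, hσ', e1] at e2
        exact e2.symm
      refine ⟨IsLocalization.mk' _ (⟨u * b, hub⟩ : (σ : B →+* B).eqLocus (RingHom.id B))
        (⟨⟨u * t, hN⟩, hut⟩ :
          (𝔮.comap ((σ : B →+* B).eqLocus (RingHom.id B)).subtype).primeCompl), ?_⟩
      rw [Localization.localRingHom_mk']
      refine IsLocalization.mk'_eq_of_eq ?_
      show u * (t : B) * b = (t : B) * (u * b)
      ring

end Summit.ResolutionOfSingularities.ResolutionOfSingularities.Theorems.WildQuotientResolution.CyclicTransfer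

end
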